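import Mathlib
import Literature.Probability.Percolation.SmoothedWhiteNoise
import HarnessLib

/-!
# Route CardyWhiteToColoured — crux `DriftBound` (stmt-CriticalPhenomena-4596): definitions for the
# Plackett/Piterbarg drift of the noise heat flow

Objects posited by line `registered` of the crux `DriftBound` (`Cruxes/DriftBound/Lines/birth.lean`,
lead c3) for the intended proof of its open stub `stub_window` — the exact `σ`-derivative of the
crossing probability of the smoothed lattice white noise (Beliaev–Muirhead–Rivera 2020, Lemma 2.22 /
Thm 2.14: Piterbarg's interpolation formula with pivotal intensities, here on the lattice and for the
noise-regularised, variance-normalised flow):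

* `innerEdges Ω δ` — the finite set of lattice edges of `ℤ²` both of whose mesh-`δ` end-points lie in
  `Ω` (as a `Finset`; `∅` if infinite, which does not happen for bounded `Ω`). The crossing event
  `discreteCrossing Ω δ A B` only depends on these edges.
* `noiseVar σ x = ∑' e, q_σ(x − m e)²` — the variance of the smoothed noise `smoothedNoise σ 1 ξ x`
  (mesh `1`, width `σ`, medial points `m = medialPoint 1`); `normWeight σ x e = q_σ(x − m e)/√(noiseVar σ x)`
  — the normalised kernel; `normNoise σ ξ x = smoothedNoise σ 1 ξ x / √(noiseVar σ x)` — the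
  **variance-normalised field** (unit variance at every point; same signs as the field).
* `regIndicator I A η x` — the **noise-regularised indicator** of an event `A` of bond
  configurations read on the edges `I`: the probability, over independent `N(0,1)` variables
  `ζ_e`, `e ∈ I`, that the configuration `{e ∈ I | x_e + η ζ_e > 0}` lies in `A`. For `η > 0` it is a
  `C^∞_b` function of `x ∈ ℝ^I` (a finite sum of products of Gaussian distribution functions
  `Φ(± x_e/η)`); as `η → 0⁺` it tends to the indicator of `{e ∈ I | x_e > 0} ∈ A` off the
  coordinate hyperplanes.
* `regFlow I A η σ = E[regIndicator I A η (normNoise σ ξ ∘ m)]` — the **regularised flow**: the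
  probability that `A` occurs for the signs of the normalised field plus an independent noise of
  size `η` (a two-parameter perturbation of the line's flow `σ ↦ P^latt`; `η → 0⁺` recovers it).
* `plackettCoeff σ x y = ∑' e, ∂_σ(normWeight σ x e) · normWeight σ y e` — the `σ`-derivative
  pairing of the normalised kernels at two points (`= ½ ∂_σ` of the correlation `R_σ(x,y)` after
  symmetrisation; the diagonal `x = y` pairing vanishes since `R_σ(x,x) ≡ 1`).
* `plackettDrift I A η σ = ∑_{i,j ∈ I} plackettCoeff σ (m i) (m j) · E[∂_j ∂_i (regIndicator I A η)(normNoise σ ξ ∘ m)]`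
  — the **Plackett/Piterbarg pair functional**: by the drift identity (helper files
  `CardyWhiteToColouredDriftBoundPlackett*.lean`) it is the exact derivative
  `d/dσ regFlow I A η σ`; its off-diagonal terms are the (regularised) pivotal-PAIR intensities of
  BMR2020 Thm 2.14, whose first order cancels by the quarter-turn∘duality symmetry of `ℤ²`.

Only definitions and their unfolding lemmas; all theorems are in the companion files
`CardyWhiteToColouredDriftBoundPlackett*.lean`.

## References

* D. Beliaev, S. Muirhead, A. Rivera, *A covariance formula for topological events of smooth
  Gaussian fields*, Ann. Probab. 48 (2020), §2.2, Lemma 2.22, Thm 2.14. [BeliaevMuirheadRivera2020]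
* S. Muirhead, H. Vanneuville, Ann. Inst. H. Poincaré Probab. Stat. 56 (2020), §2.1.
  [MuirheadVanneuville2020]
* R. L. Plackett, *A reduction formula for normal multivariate integrals*, Biometrika 41 (1954).
-/

noncomputable section

namespace Summit.CriticalPhenomena.CardyFormulaZ2.Cruxes.DriftBound.Birth

open MeasureTheory ProbabilityTheory Set
open Literature.Probability.LatticeModels Literature.Probability.Percolation

/-! ### Inner edges of a domain at mesh `δ` -/

/-- The set of **inner edges** of `Ω` at mesh `δ`: lattice edges of `ℤ²` both of whose mesh points
`δ v` lie in `Ω`. -/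
def innerEdgeSet (Ω : Set ℂ) (δ : ℝ) : Set (Sym2 (Site 2)) :=
  {e : Sym2 (Site 2) | e ∈ (zdGraph 2).edgeSet ∧ ∀ v ∈ e, meshPoint δ v ∈ Ω}

/-- Membership in the inner edge set. -/
theorem mem_innerEdgeSet_iff {Ω : Set ℂ} {δ : ℝ} {e : Sym2 (Site 2)} :
    e ∈ innerEdgeSet Ω δ ↔ e ∈ (zdGraph 2).edgeSet ∧ ∀ v ∈ e, meshPoint δ v ∈ Ω :=
  Iff.rfl

open Classical in
/-- The **inner edges** of `Ω` at mesh `δ` as a `Finset` (the empty set when there are infinitely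
many, which does not happen for bounded `Ω` and `δ > 0`). The finite coordinate set on which the
crossing event of `Ω_δ` is read and on which the Plackett drift is computed. -/
def innerEdges (Ω : Set ℂ) (δ : ℝ) : Finset (Sym2 (Site 2)) :=
  if h : (innerEdgeSet Ω δ).Finite then h.toFinset else ∅

/-- When the inner edge set is finite, `innerEdges` enumerates it. -/
theorem coe_innerEdges_of_finite {Ω : Set ℂ} {δ : ℝ} (h : (innerEdgeSet Ω δ).Finite) :
    (↑(innerEdges Ω δ) : Set (Sym2 (Site 2))) = innerEdgeSet Ω δ := by
  classical
  simp only [innerEdges, dif_pos h, Finite.coe_toFinset]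

/-- Membership in `innerEdges` for a finite inner edge set. -/
theorem mem_innerEdges_iff_of_finite {Ω : Set ℂ} {δ : ℝ} (h : (innerEdgeSet Ω δ).Finite)
    {e : Sym2 (Site 2)} : e ∈ innerEdges Ω δ ↔ e ∈ innerEdgeSet Ω δ := by
  rw [← Finset.mem_coe, coe_innerEdges_of_finite h]

/-! ### The variance-normalised field -/

/-- The **variance of the smoothed noise** at `x` (mesh `1`, width `σ`):
`noiseVar σ x = ∑' e, q_σ(x − m e)²`, `q_σ = gaussWeight σ`, `m = medialPoint 1` — the variance of
`smoothedNoise σ 1 ξ x` under the lattice white noise (unconditional sum; positive for `σ > 0`). -/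
def noiseVar (σ : ℝ) (x : ℂ) : ℝ :=
  ∑' e : (zdGraph 2).edgeSet, gaussWeight σ (x - medialPoint 1 e.1) ^ 2

/-- The **normalised kernel**: `normWeight σ x e = q_σ(x − m e) / √(noiseVar σ x)`. -/
def normWeight (σ : ℝ) (x : ℂ) (e : (zdGraph 2).edgeSet) : ℝ :=
  gaussWeight σ (x - medialPoint 1 e.1) / Real.sqrt (noiseVar σ x)

/-- The **variance-normalised smoothed noise** at `x`:
`normNoise σ ξ x = smoothedNoise σ 1 ξ x / √(noiseVar σ x)` (unit variance for `σ > 0`; it has the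
sign of the field, so the sign configuration and all crossing probabilities are unchanged). -/
def normNoise (σ : ℝ) (ξ : (zdGraph 2).edgeSet → ℝ) (x : ℂ) : ℝ :=
  smoothedNoise σ 1 ξ x / Real.sqrt (noiseVar σ x)

/-- The normalised field is the `ℓ¹`-linear Gaussian series with the normalised kernel:
`normNoise σ ξ x = ∑' e, normWeight σ x e · ξ_e`. -/
theorem normNoise_eq_tsum (σ : ℝ) (ξ : (zdGraph 2).edgeSet → ℝ) (x : ℂ) :
    normNoise σ ξ x = ∑' e : (zdGraph 2).edgeSet, normWeight σ x e * ξ e := by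
  unfold normNoise normWeight smoothedNoise
  rw [← tsum_div_const]
  refine tsum_congr fun e => ?_
  rw [gaussWeight]
  ring


/-- **The normalised field as an `ℓ¹`-linear Gaussian series (registered form).** Fully qualified
`∀`-form of `normNoise_eq_tsum`, registered as a sub-goal stub of the crux item so that this
definitions file of line `registered` lands under `--supports`; it is the bridge placing
`normNoise` in the scope of the generic drift identity (`X_i = ∑' e, G i e ξ_e`). -/
theorem pl_normNoise_eq_tsum : ∀ (σ : ℝ) (ξ : (Literature.Probability.LatticeModels.zdGraph 2).edgeSet → ℝ) (x : ℂ), Summit.CriticalPhenomena.CardyFormulaZ2.Cruxes.DriftBound.Birth.normNoise σ ξ x = ∑' e : (Literature.Probability.LatticeModels.zdGraph 2).edgeSet, Summit.CriticalPhenomena.CardyFormulaZ2.Cruxes.DriftBound.Birth.normWeight σ x e * ξ e :=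
  fun σ ξ x => normNoise_eq_tsum σ ξ x

/-! ### The noise-regularised indicator and the regularised flow -/

/-- The **noise-regularised indicator** of an event `A` of bond configurations, read on the finite
edge set `I`, at noise level `η`: for `x ∈ ℝ^I`,
`regIndicator I A η x = P_ζ({e ∈ I | x_e + η ζ_e > 0} ∈ A)`, the `ζ_e` i.i.d. `N(0,1)`
(`Measure.pi`). For `η > 0` a smooth function of `x` with bounded derivatives of all orders; for
`η = 0` the indicator of `{e ∈ I | x_e > 0} ∈ A`. -/
def regIndicator (I : Finset (Sym2 (Site 2))) (A : Set (Set (Sym2 (Site 2)))) (η : ℝ)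
    (x : I → ℝ) : ℝ :=
  (Measure.pi fun _ : I => gaussianReal 0 1).real
    {ζ : I → ℝ | {e : Sym2 (Site 2) | ∃ h : e ∈ I, 0 < x ⟨e, h⟩ + η * ζ ⟨e, h⟩} ∈ A}

/-- The regularised indicator takes values in `[0, 1]`. -/
theorem regIndicator_mem_Icc (I : Finset (Sym2 (Site 2))) (A : Set (Set (Sym2 (Site 2)))) (η : ℝ)
    (x : I → ℝ) : regIndicator I A η x ∈ Icc (0 : ℝ) 1 :=
  ⟨measureReal_nonneg, measureReal_le_one⟩

/-- The **regularised flow**: `regFlow I A η σ = E_ξ[regIndicator I A η (e ↦ normNoise σ ξ (m e))]`,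
the probability that `A` occurs for the signs of the normalised smoothed noise (width `σ`, mesh `1`)
read at the medial points of the edges of `I`, plus an independent noise of size `η` on each. -/
def regFlow (I : Finset (Sym2 (Site 2))) (A : Set (Set (Sym2 (Site 2)))) (η σ : ℝ) : ℝ :=
  ∫ ξ, regIndicator I A η (fun i : I => normNoise σ ξ (medialPoint 1 i.1)) ∂latticeWhiteNoise

/-! ### The Plackett/Piterbarg pair functional -/

/-- The **Plackett coefficient** of the pair of points `(x, y)` at width `σ`:
`plackettCoeff σ x y = ∑' e, ∂_σ(normWeight σ x e) · normWeight σ y e` (the `σ`-derivative taken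
as `deriv`; the normalised kernels are smooth in `σ > 0`). -/
def plackettCoeff (σ : ℝ) (x y : ℂ) : ℝ :=
  ∑' e : (zdGraph 2).edgeSet, deriv (fun s : ℝ => normWeight s x e) σ * normWeight σ y e

/-- The **Plackett/Piterbarg pair functional** of the event `A` on the edges `I`, at noise level
`η` and width `σ`:
`plackettDrift I A η σ = ∑_{i,j ∈ I} plackettCoeff σ (m i) (m j) · E_ξ[∂_j ∂_i (regIndicator I A η)(X̃^σ ξ)]`,
where `X̃^σ ξ = (normNoise σ ξ (m i))_{i ∈ I}` and `∂_i` is the partial derivative along the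
coordinate `i` (`fderiv` against `Pi.single i 1`). The drift identity of the companion files states
`HasDerivAt (regFlow I A η) (plackettDrift I A η σ) σ` for `σ > 0`, `η > 0`. -/
def plackettDrift (I : Finset (Sym2 (Site 2))) (A : Set (Set (Sym2 (Site 2)))) (η σ : ℝ) : ℝ :=
  ∑ i : I, ∑ j : I, plackettCoeff σ (medialPoint 1 i.1) (medialPoint 1 j.1) *
    ∫ ξ, fderiv ℝ (fun y : I → ℝ => fderiv ℝ (regIndicator I A η) y (Pi.single i 1))
      (fun i' : I => normNoise σ ξ (medialPoint 1 i'.1)) (Pi.single j 1) ∂latticeWhiteNoise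

end Summit.CriticalPhenomena.CardyFormulaZ2.Cruxes.DriftBound.Birth

end
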